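import Literature.Geometry.DiscreteGeometry.KerteszNorthernPoints
import Literature.Geometry.DiscreteGeometry.KerteszLiftPenalty
import Literature.Geometry.DiscreteGeometry.KerteszLocalRigidity
import Literature.Geometry.DiscreteGeometry.KerteszAzimuthArcs
import Literature.Geometry.DiscreteGeometry.KerteszBudgetCert
import HarnessLib

/-!
# Kertész 1994 — nine points on the hemisphere: the discharge

Topic `Literature/Geometry/DiscreteGeometry`; the assembly of the provefact series for the named
fact `kertesz1994_ninePointsHemisphere` (`KerteszNinePointsHemisphere.lean`): nine unit vectors of
`ℝ³` in a closed hemisphere `⟪e, ·⟫ ≥ 0`, pairwise at distance `≥ 1`, have (at least) six points ON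
the equator `⟪e, ·⟫ = 0` — G. Kertész, *Nine points on the hemisphere* (1994).  The proof is the
azimuth budget about the pole (cell record HOME/cf-lit/kertesz/BLUEPRINT.md of
`run/shared/lean/pub/crystal3d-full`), following the printed strategy of successive range-narrowing
(Zbl 0822.52005: "exactly six of the points must have latitude less than `30°` … the three
'northern' points … latitude greater than `45°` and less than `60°`, and so on; until at the end the
latitudes, and relative longitudes, are completely determined"):

1. `nine_point_structure` (tree): three northern points `h₁, h₂, h₃` (`⟪e, hⱼ⟫ = wⱼ ∈ (1/2, 1)`),
   six low points (`⟪e, u⟫ = z_u ∈ [0, 1/2)`).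
2. Polar coordinates about `e` (Musin's projection, as in `no_seven_in_band`); azimuths lifted to
   `[0, 2π)` relative to `h₁`; the three northern azimuths `0 = φ₁ ≤ φ₂ ≤ φ₃ < 2π` cut the circle
   into three sectors holding `m₁ + m₂ + m₃ = 6` low points.
3. Pair bounds (`KerteszNorthernPoints.lean`) as bounds on azimuth differences, for both arcs
   (`arccos_le_and_le_of_cos_le`), and the walk through an arc (`arc_lower_bound`) give the crude
   budget `KerteszCert.CrudeHyps`; the certified branch and bound (`KerteszBudgetCert.lean`) leaves
   only the composition `(2, 2, 2)` and the window `wⱼ ∈ (0.78, 0.84)`.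
4. With two low points per sector the sector walk is exact; the lift penalty
   (`sector_lift_penalty`) gives `KerteszCert.SixtyHyps` with penalties `(z + z')/4`; the certified
   budget pins `wⱼ` into `[0.8138, 0.8192]` (`sixty_cube`) and the local rigidity lemma
   (`kertesz_local_rigidity`) forces all penalties to vanish: every low point is on the equator.

Main results: `kertesz1994_low_equatorial`, **`kertesz1994_ninePointsHemisphere_holds`**,
**`kertesz1994_nineHemisphere_holds`**.  Theorems only (no definitions, no named facts).  Trust
base: the standard axioms (`propext`, `Classical.choice`, `Quot.sound`) — the branch-and-bound run
`KerteszCert.allChecks_eq_true` is evaluated by the KERNEL (`decide +kernel`) since the second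
version of `KerteszBudgetCert.lean`; the first version of this series ran it by `native_decide`
(`Lean.ofReduceBool`, computational grade), and nothing else in the chain ever used compiled
evaluation.

## References
* G. Kertész, *Nine points on the hemisphere*, in: Intuitive Geometry (Szeged 1991), Colloq. Math.
  Soc. János Bolyai 63, North-Holland (1994) 189–196; review R. Dawson, Zbl 0822.52005. [`Kertesz1994`]
* O. R. Musin, *The one-sided kissing number in four dimensions*, Period. Math. Hungar. 53 (2006)
  209–225, §2 (projection along meridians). [`Musin2006`]
-/

noncomputable section

namespace Literature.Geometry.DiscreteGeometry

open Real RealInnerProductSpace KerteszCert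

/-! ### Real-variable tools: lifted azimuths, both arcs, walks through filtered sets -/

/-- Unit vectors at distance `≥ 1` have inner product `≤ 1/2`. [folklore] -/
private theorem inner_le_half_of_one_le_dist {v w : EuclideanSpace ℝ (Fin 3)} (hv : ‖v‖ = 1)
    (hw : ‖w‖ = 1) (h : 1 ≤ dist v w) : ⟪v, w⟫ ≤ 1 / 2 := by
  have h2 : dist v w ^ 2 = 2 - 2 * ⟪v, w⟫ := by
    rw [dist_eq_norm, norm_sub_sq_real, hv, hw]; ring
  nlinarith [h, h2, dist_nonneg (x := v) (y := w)]

/-- The azimuth lifted relative to a base azimuth lies in `[0, 2π)`. [folklore] -/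
private theorem lift_range {θ θ₁ a : ℝ} (hθ : -π < θ ∧ θ ≤ π) (hθ₁ : -π < θ₁ ∧ θ₁ ≤ π)
    (ha : a = if θ < θ₁ then θ - θ₁ + 2 * π else θ - θ₁) : 0 ≤ a ∧ a < 2 * π := by
  rw [ha]
  split_ifs with h
  · constructor <;> linarith [hθ.1, hθ₁.2]
  · push Not at h
    constructor <;> linarith [hθ.2, hθ₁.1]

/-- Lifting changes azimuth differences by multiples of `2π` only. [folklore] -/
private theorem lift_cos {θ θ' θ₁ a a' : ℝ}
    (ha : a = if θ < θ₁ then θ - θ₁ + 2 * π else θ - θ₁)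
    (ha' : a' = if θ' < θ₁ then θ' - θ₁ + 2 * π else θ' - θ₁) :
    cos (a' - a) = cos (θ' - θ) := by
  have hk : ∃ k : ℤ, a = θ - θ₁ + k * (2 * π) := by
    rw [ha]
    split_ifs
    · exact ⟨1, by push_cast; ring⟩
    · exact ⟨0, by push_cast; ring⟩
  have hk' : ∃ k : ℤ, a' = θ' - θ₁ + k * (2 * π) := by
    rw [ha']
    split_ifs
    · exact ⟨1, by push_cast; ring⟩
    · exact ⟨0, by push_cast; ring⟩
  obtain ⟨k, hk⟩ := hk
  obtain ⟨k', hk'⟩ := hk'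
  have : a' - a = (θ' - θ) + ((k' - k : ℤ) : ℝ) * (2 * π) := by
    rw [hk, hk']; push_cast; ring
  rw [this, Real.cos_add_int_mul_two_pi]

/-- **Both arcs between two lifted azimuths obey the pair bound**: for `a, a' ∈ [0, 2π)` with
`cos (a' − a) ≤ c`, both `|a' − a|` and `2π − |a' − a|` are `≥ arccos c`.
[cite: Kertesz1994, proof (relative longitudes)] -/
theorem arccos_le_abs_sub_of_cos_le {a a' c : ℝ} (ha : 0 ≤ a ∧ a < 2 * π)
    (ha' : 0 ≤ a' ∧ a' < 2 * π) (h : cos (a' - a) ≤ c) :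
    arccos c ≤ |a' - a| ∧ arccos c ≤ 2 * π - |a' - a| := by
  have hx0 : 0 ≤ |a' - a| := abs_nonneg _
  have hx1 : |a' - a| ≤ 2 * π := by
    rw [abs_le]; constructor <;> linarith [ha.1, ha.2, ha'.1, ha'.2]
  have hc : cos |a' - a| ≤ c := by rwa [Real.cos_abs]
  exact arccos_le_and_le_of_cos_le hx0 hx1 hc

/-- **The walk through a sector** (no wrap): the low points `u ∈ L` with `P u` have injective
lifted azimuths `A u` with `A u − α ≥ D_a`, `β − A u ≥ D_b` and gaps `≥ G`; then
`walkR D_a D_b m G ≤ β − α` for `m = #{u ∈ L | P u}`. [cite: Kertesz1994, proof (relative longitudes)] -/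
theorem walkR_filter_le {ι : Type*} (L : Finset ι) (P : ι → Prop) [DecidablePred P] (A : ι → ℝ)
    {α β Da Db G : ℝ} (hinj : ∀ u ∈ L, ∀ u' ∈ L, A u = A u' → u = u')
    (hα : ∀ u ∈ L, P u → Da ≤ A u - α) (hβ : ∀ u ∈ L, P u → Db ≤ β - A u)
    (hG : ∀ u ∈ L, ∀ u' ∈ L, A u < A u' → G ≤ A u' - A u) (hαβ : 0 ≤ β - α) :
    walkR Da Db (L.filter P).card G ≤ β - α := by
  classical
  unfold walkR
  split_ifs with h0
  · exact hαβ
  · set S := (L.filter P).image A with hS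
    have hcard : S.card = (L.filter P).card := by
      rw [hS]
      refine Finset.card_image_of_injOn ?_
      intro u hu u' hu' h
      simp only [Finset.coe_filter, Set.mem_setOf_eq] at hu hu'
      exact hinj u hu.1 u' hu'.1 h
    have hne : S.Nonempty := by
      rw [← Finset.card_pos, hcard]; exact Nat.pos_of_ne_zero h0
    have h1 : ∀ s ∈ S, Da ≤ s - α := by
      intro s hs
      obtain ⟨u, hu, rfl⟩ := Finset.mem_image.1 hs
      rw [Finset.mem_filter] at hu
      exact hα u hu.1 hu.2
    have h2 : ∀ s ∈ S, Db ≤ β - s := by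
      intro s hs
      obtain ⟨u, hu, rfl⟩ := Finset.mem_image.1 hs
      rw [Finset.mem_filter] at hu
      exact hβ u hu.1 hu.2
    have h3 : ∀ s ∈ S, ∀ s' ∈ S, s < s' → G ≤ s' - s := by
      intro s hs s' hs' hlt
      obtain ⟨u, hu, rfl⟩ := Finset.mem_image.1 hs
      obtain ⟨u', hu', rfl⟩ := Finset.mem_image.1 hs'
      rw [Finset.mem_filter] at hu hu'
      exact hG u hu.1 u' hu'.1 hlt
    have key := arc_lower_bound S hne h1 h2 h3
    rw [hcard] at key
    exact key

/-- **The walk through a wrapping arc**: from the azimuth `α` up through `2π ≡ 0` to `β + 2π`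
(`β ≤ α`), through the low points with `A u ≥ α` or `A u < β`; the pair bounds are given for both
arcs (`B ≤ |Δ|` and `B ≤ 2π − |Δ|`). [cite: Kertesz1994, proof (relative longitudes)] -/
theorem walkR_filter_le_wrap {ι : Type*} (L : Finset ι) (P : ι → Prop) [DecidablePred P]
    (A : ι → ℝ) {α β Da Db G : ℝ} (hinj : ∀ u ∈ L, ∀ u' ∈ L, A u = A u' → u = u')
    (hrange : ∀ u ∈ L, 0 ≤ A u ∧ A u < 2 * π) (hβα : β ≤ α)
    (hP : ∀ u ∈ L, P u → α ≤ A u ∨ A u < β)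
    (hα : ∀ u ∈ L, P u → Da ≤ |A u - α| ∧ Da ≤ 2 * π - |A u - α|)
    (hβ : ∀ u ∈ L, P u → Db ≤ |A u - β| ∧ Db ≤ 2 * π - |A u - β|)
    (hG : ∀ u ∈ L, ∀ u' ∈ L, u ≠ u' → G ≤ |A u' - A u| ∧ G ≤ 2 * π - |A u' - A u|)
    (hE : 0 ≤ β + 2 * π - α) :
    walkR Da Db (L.filter P).card G ≤ β + 2 * π - α := by
  classical
  unfold walkR
  split_ifs with h0
  · exact hE
  · set f : ι → ℝ := fun u => if A u < β then A u + 2 * π else A u with hf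
    have hfval : ∀ u, (A u < β → f u = A u + 2 * π) ∧ (¬ A u < β → f u = A u) := by
      intro u
      constructor
      · intro h; simp only [hf, if_pos h]
      · intro h; simp only [hf, if_neg h]
    set S := (L.filter P).image f with hS
    have hcard : S.card = (L.filter P).card := by
      rw [hS]
      refine Finset.card_image_of_injOn ?_
      intro u hu u' hu' h
      simp only [Finset.coe_filter, Set.mem_setOf_eq] at hu hu'
      apply hinj u hu.1 u' hu'.1
      have h : f u = f u' := h
      by_cases c : A u < β
      · by_cases c' : A u' < β
        · rw [(hfval u).1 c, (hfval u').1 c'] at h; linarith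
        · rw [(hfval u).1 c, (hfval u').2 c'] at h
          linarith [(hrange u hu.1).1, (hrange u' hu'.1).2]
      · by_cases c' : A u' < β
        · rw [(hfval u).2 c, (hfval u').1 c'] at h
          linarith [(hrange u hu.1).2, (hrange u' hu'.1).1]
        · rw [(hfval u).2 c, (hfval u').2 c'] at h; exact h
    have hne : S.Nonempty := by
      rw [← Finset.card_pos, hcard]; exact Nat.pos_of_ne_zero h0
    have h1 : ∀ s ∈ S, Da ≤ s - α := by
      intro s hs
      obtain ⟨u, hu, rfl⟩ := Finset.mem_image.1 hs
      rw [Finset.mem_filter] at hu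
      obtain ⟨hD1, hD2⟩ := hα u hu.1 hu.2
      by_cases c : A u < β
      · rw [(hfval u).1 c]
        have : |A u - α| = α - A u := by
          rw [abs_of_nonpos (by linarith)]; ring
        rw [this] at hD2
        linarith
      · rw [(hfval u).2 c]
        have hαu : α ≤ A u := (hP u hu.1 hu.2).resolve_right c
        rw [abs_of_nonneg (by linarith)] at hD1
        exact hD1
    have h2 : ∀ s ∈ S, Db ≤ β + 2 * π - s := by
      intro s hs
      obtain ⟨u, hu, rfl⟩ := Finset.mem_image.1 hs
      rw [Finset.mem_filter] at hu
      obtain ⟨hD1, hD2⟩ := hβ u hu.1 hu.2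
      by_cases c : A u < β
      · rw [(hfval u).1 c]
        rw [abs_of_nonpos (by linarith)] at hD1
        linarith
      · rw [(hfval u).2 c]
        push Not at c
        rw [abs_of_nonneg (by linarith)] at hD2
        linarith
    have h3 : ∀ s ∈ S, ∀ s' ∈ S, s < s' → G ≤ s' - s := by
      intro s hs s' hs' hlt
      obtain ⟨u, hu, rfl⟩ := Finset.mem_image.1 hs
      obtain ⟨u', hu', rfl⟩ := Finset.mem_image.1 hs'
      rw [Finset.mem_filter] at hu hu'
      have hne' : u ≠ u' := by
        rintro rfl; exact lt_irrefl _ hlt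
      obtain ⟨hG1, hG2⟩ := hG u hu.1 u' hu'.1 hne'
      by_cases c : A u < β
      · by_cases c' : A u' < β
        · rw [(hfval u).1 c, (hfval u').1 c'] at hlt ⊢
          rw [abs_of_pos (by linarith)] at hG1
          linarith
        · rw [(hfval u).1 c, (hfval u').2 c'] at hlt
          linarith [(hrange u hu.1).1, (hrange u' hu'.1).2]
      · by_cases c' : A u' < β
        · rw [(hfval u).2 c, (hfval u').1 c'] at hlt ⊢
          push Not at c
          rw [abs_of_neg (by linarith)] at hG2
          linarith
        · rw [(hfval u).2 c, (hfval u').2 c'] at hlt ⊢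
          rw [abs_of_pos (by linarith)] at hG1
          linarith
    have key := arc_lower_bound S hne h1 h2 h3
    rw [hcard] at key
    linarith

/-- A horizontal radius is positive off the poles: `ρ ≥ 0`, `ρ² = 1 − z²`, `0 ≤ z < 1`. [folklore] -/
private theorem rad_pos {ρ z : ℝ} (h0 : 0 ≤ ρ) (h : ρ ^ 2 = 1 - z ^ 2) (hz0 : 0 ≤ z) (hz1 : z < 1) :
    0 < ρ := by
  rcases h0.lt_or_eq with hp | hp
  · exact hp
  · exfalso
    rw [← hp] at h
    nlinarith

/-- High–high: `r r' c + w w' ≤ 1/2` gives `c ≤ (1/2 − ww')/(r r')`. [folklore] -/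
private theorem hh_cos {w w' r r' c : ℝ} (hr : 0 < r) (hr' : 0 < r') (hrw : √(1 - w ^ 2) = r)
    (hrw' : √(1 - w' ^ 2) = r') (h : r * r' * c + w * w' ≤ 1 / 2) : c ≤ cr w w' := by
  unfold cr
  rw [hrw, hrw', le_div_iff₀ (mul_pos hr hr')]
  linarith

/-- High–low: `r s c + w z ≤ 1/2` gives the height-free `c ≤ 1/(2r)` (`mul_cos_le_half_of_high_low`)
and the exact `c ≤ (1/2 − wz)/(r s)`. [folklore] -/
private theorem hl_cos {w z r s c : ℝ} (hz0 : 0 ≤ z) (hz1 : z ≤ 1 / 2) (hw0 : 1 / 2 ≤ w)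
    (hw1 : w ≤ 1) (hr : 0 < r) (hs : 0 < s) (hs2 : s ^ 2 = 1 - z ^ 2) (hrw : √(1 - w ^ 2) = r)
    (hsz : √(1 - z ^ 2) = s) (h : r * s * c + w * z ≤ 1 / 2) :
    c ≤ 1 / (2 * √(1 - w ^ 2)) ∧ c ≤ (1 / 2 - w * z) / (√(1 - w ^ 2) * √(1 - z ^ 2)) := by
  have h1 : r * c ≤ 1 / 2 := mul_cos_le_half_of_high_low hz0 hz1 hw0 hw1 hr.le hs.le hs2 h
  constructor
  · rw [hrw, le_div_iff₀ (by positivity)]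
    linarith
  · rw [hrw, hsz, le_div_iff₀ (mul_pos hr hs)]
    linarith

/-- Low–low: `s s' c + z z' ≤ 1/2` gives `c ≤ √(1/3)` (`cos_le_sqrt_third_of_low_low`) and the exact
`c ≤ (1/2 − zz')/(s s')`. [folklore] -/
private theorem ll_cos {z z' s s' c : ℝ} (hz0 : 0 ≤ z) (hz1 : z ≤ 1 / 2) (hz0' : 0 ≤ z')
    (hz1' : z' ≤ 1 / 2) (hs : 0 < s) (hs' : 0 < s') (hs2 : s ^ 2 = 1 - z ^ 2)
    (hs2' : s' ^ 2 = 1 - z' ^ 2) (hsz : √(1 - z ^ 2) = s) (hsz' : √(1 - z' ^ 2) = s')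
    (h : s * s' * c + z * z' ≤ 1 / 2) :
    c ≤ √(1 / 3) ∧ c ≤ (1 / 2 - z * z') / (√(1 - z ^ 2) * √(1 - z' ^ 2)) := by
  constructor
  · exact cos_le_sqrt_third_of_low_low hz0 hz1 hz0' hz1' hs.le hs'.le hs2 hs2' h
  · rw [hsz, hsz', le_div_iff₀ (mul_pos hs hs')]
    linarith

/-! ### The nine-point arrangement in polar coordinates: the budget hypotheses -/

set_option maxHeartbeats 1000000 in
/-- **Core of the discharge.**  In the setting of `kertesz1994_ninePointsHemisphere`, with an
orthonormal frame `b` (`b 2 = e`) and the three northern points `h₁, h₂, h₃` listed by increasing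
azimuth, every point of height `< 1/2` lies on the equator: the crude budget (`CrudeHyps`, refuted
off `(2,2,2)` and off the window by `crude_pattern`, `crude_window`), the exact two-point sector
walks with the lift penalty (`sector_lift_penalty`, giving `SixtyHyps` and `sixty_cube`), and
`kertesz_local_rigidity`. [cite: Kertesz1994, Theorem (proof: relative longitudes)] -/
theorem low_equatorial_of_frame {e : EuclideanSpace ℝ (Fin 3)} (he : ‖e‖ = 1)
    {T : Finset (EuclideanSpace ℝ (Fin 3))}
    (hn : ∀ v ∈ T, ‖v‖ = 1) (hhemi : ∀ v ∈ T, 0 ≤ ⟪e, v⟫)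
    (hsep : ∀ v ∈ T, ∀ w ∈ T, v ≠ w → 1 ≤ dist v w) (h9 : T.card = 9)
    (b : OrthonormalBasis (Fin 3) ℝ (EuclideanSpace ℝ (Fin 3))) (hb2 : b 2 = e)
    {h₁ h₂ h₃ : EuclideanSpace ℝ (Fin 3)} (hh₁ : h₁ ∈ T) (hh₂ : h₂ ∈ T) (hh₃ : h₃ ∈ T)
    (h12 : h₁ ≠ h₂) (h13 : h₁ ≠ h₃) (h23 : h₂ ≠ h₃)
    (hw₁ : 1 / 2 < ⟪e, h₁⟫) (hw₂ : 1 / 2 < ⟪e, h₂⟫) (hw₃ : 1 / 2 < ⟪e, h₃⟫)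
    (hθ₁₂ : Complex.arg ⟨⟪b 0, h₁⟫, ⟪b 1, h₁⟫⟩ ≤ Complex.arg ⟨⟪b 0, h₂⟫, ⟪b 1, h₂⟫⟩)
    (hθ₂₃ : Complex.arg ⟨⟪b 0, h₂⟫, ⟪b 1, h₂⟫⟩ ≤ Complex.arg ⟨⟪b 0, h₃⟫, ⟪b 1, h₃⟫⟩) :
    ∀ v ∈ T, ⟪e, v⟫ < 1 / 2 → ⟪e, v⟫ = 0 := by
  classical
  obtain ⟨hH3, hL6, hhalf⟩ := nine_point_structure he hn hhemi hsep h9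
  set L := T.filter fun u => ⟪e, u⟫ < 1 / 2 with hLdef
  have hLT : ∀ {u}, u ∈ L → u ∈ T := fun hu => (Finset.mem_filter.1 hu).1
  have hLz : ∀ {u}, u ∈ L → 0 ≤ ⟪e, u⟫ ∧ ⟪e, u⟫ < 1 / 2 := fun hu =>
    ⟨hhemi _ (Finset.mem_filter.1 hu).1, (Finset.mem_filter.1 hu).2⟩
  have hi : ∀ {x y}, x ∈ T → y ∈ T → x ≠ y → ⟪x, y⟫ ≤ 1 / 2 := fun hx hy hxy =>
    inner_le_half_of_one_le_dist (hn _ hx) (hn _ hy) (hsep _ hx _ hy hxy)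
  /- heights of the northern points: `1/2 < w < 1` -/
  have hlt1 : ∀ {h h'}, h ∈ T → h' ∈ T → h ≠ h' → 1 / 2 < ⟪e, h'⟫ → ⟪e, h⟫ < 1 := by
    intro h h' hh hh' hne hw'
    have hle : ⟪e, h⟫ ≤ 1 := by
      have := real_inner_le_norm e h; rw [he, hn h hh] at this; linarith
    rcases hle.lt_or_eq with hlt | heq
    · exact hlt
    · exfalso
      have heh : e = h := (inner_eq_one_iff_of_norm_eq_one he (hn h hh)).1 heq
      have := hi hh hh' hne
      rw [← heh] at this
      linarith
  have hw₁1 : ⟪e, h₁⟫ < 1 := hlt1 hh₁ hh₂ h12 hw₂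
  have hw₂1 : ⟪e, h₂⟫ < 1 := hlt1 hh₂ hh₁ h12.symm hw₁
  have hw₃1 : ⟪e, h₃⟫ < 1 := hlt1 hh₃ hh₁ h13.symm hw₁
  /- polar coordinates about `e` (opaque local functions) -/
  obtain ⟨θ, hθ⟩ : ∃ θ : EuclideanSpace ℝ (Fin 3) → ℝ,
      ∀ u, θ u = Complex.arg ⟨⟪b 0, u⟫, ⟪b 1, u⟫⟩ := ⟨_, fun u => rfl⟩
  obtain ⟨ρ, hρ⟩ : ∃ ρ : EuclideanSpace ℝ (Fin 3) → ℝ,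
      ∀ u, ρ u = ‖(⟨⟪b 0, u⟫, ⟪b 1, u⟫⟩ : ℂ)‖ := ⟨_, fun u => rfl⟩
  have hθ₁₂' : θ h₁ ≤ θ h₂ := by rw [hθ, hθ]; exact hθ₁₂
  have hθ₂₃' : θ h₂ ≤ θ h₃ := by rw [hθ, hθ]; exact hθ₂₃
  have hρ0 : ∀ u, 0 ≤ ρ u := fun u => by rw [hρ]; exact norm_nonneg _
  have hXρ : ∀ u, ⟪b 0, u⟫ = ρ u * cos (θ u) := fun u => by
    rw [hρ, hθ]; exact (Complex.norm_mul_cos_arg ⟨⟪b 0, u⟫, ⟪b 1, u⟫⟩).symm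
  have hYρ : ∀ u, ⟪b 1, u⟫ = ρ u * sin (θ u) := fun u => by
    rw [hρ, hθ]; exact (Complex.norm_mul_sin_arg ⟨⟪b 0, u⟫, ⟪b 1, u⟫⟩).symm
  have hρsq : ∀ u ∈ T, ρ u ^ 2 = 1 - ⟪e, u⟫ ^ 2 := by
    intro u hu
    have h1 : ⟪u, u⟫ = 1 := by rw [real_inner_self_eq_norm_sq, hn u hu]; norm_num
    rw [inner_eq_sum_three b, hb2] at h1
    have h2 : ρ u ^ 2 = ⟪b 0, u⟫ ^ 2 + ⟪b 1, u⟫ ^ 2 := by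
      rw [hρ, Complex.sq_norm, Complex.normSq_mk]; ring
    nlinarith [h1, h2]
  have hinner : ∀ u u', ⟪u, u'⟫ = ρ u * ρ u' * cos (θ u' - θ u) + ⟪e, u⟫ * ⟪e, u'⟫ := by
    intro u u'
    rw [inner_eq_sum_three b u u', hb2, cos_sub, hXρ u, hXρ u', hYρ u, hYρ u']
    ring
  have hθrange : ∀ u, -π < θ u ∧ θ u ≤ π := fun u => by
    rw [hθ]; exact ⟨Complex.neg_pi_lt_arg _, Complex.arg_le_pi _⟩
  have hρeq : ∀ u ∈ T, √(1 - ⟪e, u⟫ ^ 2) = ρ u := fun u hu => by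
    rw [← hρsq u hu, Real.sqrt_sq (hρ0 u)]
  have hρpos : ∀ u ∈ T, ⟪e, u⟫ < 1 → 0 < ρ u := fun u hu h1 =>
    rad_pos (hρ0 u) (hρsq u hu) (hhemi u hu) h1
  /- lifted azimuths relative to `h₁` -/
  obtain ⟨A, hA⟩ : ∃ A : EuclideanSpace ℝ (Fin 3) → ℝ,
      ∀ u, A u = if θ u < θ h₁ then θ u - θ h₁ + 2 * π else θ u - θ h₁ := ⟨_, fun u => rfl⟩
  have hArange : ∀ u, 0 ≤ A u ∧ A u < 2 * π := fun u =>
    lift_range (hθrange u) (hθrange h₁) (hA u)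
  have hAcos : ∀ u u', cos (A u' - A u) = cos (θ u' - θ u) := fun u u' =>
    lift_cos (hA u) (hA u')
  have hA1 : A h₁ = 0 := by
    rw [hA, if_neg (lt_irrefl _), sub_self]
  have hA2 : A h₂ = θ h₂ - θ h₁ := by
    rw [hA, if_neg (not_lt.2 hθ₁₂')]
  have hA3 : A h₃ = θ h₃ - θ h₁ := by
    rw [hA, if_neg (not_lt.2 (hθ₁₂'.trans hθ₂₃'))]
  have hφ12 : A h₁ ≤ A h₂ := by rw [hA1, hA2]; linarith
  have hφ23 : A h₂ ≤ A h₃ := by rw [hA2, hA3]; linarith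
  have hφ3 : A h₃ < 2 * π := (hArange h₃).2
  /- pair bounds: high–high -/
  have pairHH : ∀ {h h'}, h ∈ T → h' ∈ T → h ≠ h' → 1 / 2 < ⟪e, h⟫ → ⟪e, h⟫ < 1 →
      1 / 2 < ⟪e, h'⟫ → ⟪e, h'⟫ < 1 →
      -1 ≤ cr ⟪e, h⟫ ⟪e, h'⟫ ∧ Ar ⟪e, h⟫ ⟪e, h'⟫ ≤ |A h' - A h| ∧
        Ar ⟪e, h⟫ ⟪e, h'⟫ ≤ 2 * π - |A h' - A h| := by
    intro h h' hh hh' hne hw hw1 hw' hw'1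
    have hle := hi hh hh' hne
    rw [hinner, ← hAcos] at hle
    have hc : cos (A h' - A h) ≤ cr ⟪e, h⟫ ⟪e, h'⟫ :=
      hh_cos (hρpos h hh hw1) (hρpos h' hh' hw'1) (hρeq h hh) (hρeq h' hh') hle
    exact ⟨(Real.neg_one_le_cos _).trans hc, arccos_le_abs_sub_of_cos_le (hArange h) (hArange h') hc⟩
  /- pair bounds: high–low (height-free and exact) -/
  have pairHL : ∀ {h u}, h ∈ T → u ∈ L → 1 / 2 < ⟪e, h⟫ → ⟪e, h⟫ < 1 →
      (Dr ⟪e, h⟫ ≤ |A u - A h| ∧ Dr ⟪e, h⟫ ≤ 2 * π - |A u - A h|) ∧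
      (arccos ((1 / 2 - ⟪e, h⟫ * ⟪e, u⟫) / (√(1 - ⟪e, h⟫ ^ 2) * √(1 - ⟪e, u⟫ ^ 2))) ≤ |A u - A h| ∧
        arccos ((1 / 2 - ⟪e, h⟫ * ⟪e, u⟫) / (√(1 - ⟪e, h⟫ ^ 2) * √(1 - ⟪e, u⟫ ^ 2))) ≤
          2 * π - |A u - A h|) := by
    intro h u hh hu hw hw1
    obtain ⟨hz0, hz1⟩ := hLz hu
    have huT := hLT hu
    have hne : h ≠ u := by rintro rfl; linarith
    have hle := hi hh huT hne
    rw [hinner, ← hAcos] at hle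
    obtain ⟨hc1, hc2⟩ := hl_cos hz0 hz1.le hw.le hw1.le (hρpos h hh hw1)
      (hρpos u huT (by linarith)) (hρsq u huT) (hρeq h hh) (hρeq u huT) hle
    exact ⟨arccos_le_abs_sub_of_cos_le (hArange h) (hArange u) hc1,
      arccos_le_abs_sub_of_cos_le (hArange h) (hArange u) hc2⟩
  /- pair bounds: low–low (height-free and exact) -/
  have pairLL : ∀ {u u'}, u ∈ L → u' ∈ L → u ≠ u' →
      (Gr ≤ |A u' - A u| ∧ Gr ≤ 2 * π - |A u' - A u|) ∧
      (arccos ((1 / 2 - ⟪e, u⟫ * ⟪e, u'⟫) / (√(1 - ⟪e, u⟫ ^ 2) * √(1 - ⟪e, u'⟫ ^ 2))) ≤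
          |A u' - A u| ∧
        arccos ((1 / 2 - ⟪e, u⟫ * ⟪e, u'⟫) / (√(1 - ⟪e, u⟫ ^ 2) * √(1 - ⟪e, u'⟫ ^ 2))) ≤
          2 * π - |A u' - A u|) := by
    intro u u' hu hu' hne
    obtain ⟨hz0, hz1⟩ := hLz hu
    obtain ⟨hz0', hz1'⟩ := hLz hu'
    have huT := hLT hu
    have huT' := hLT hu'
    have hle := hi huT huT' hne
    rw [hinner, ← hAcos] at hle
    obtain ⟨hc1, hc2⟩ := ll_cos hz0 hz1.le hz0' hz1'.le (hρpos u huT (by linarith))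
      (hρpos u' huT' (by linarith)) (hρsq u huT) (hρsq u' huT') (hρeq u huT) (hρeq u' huT') hle
    exact ⟨arccos_le_abs_sub_of_cos_le (hArange u) (hArange u') hc1,
      arccos_le_abs_sub_of_cos_le (hArange u) (hArange u') hc2⟩
  /- injectivity of the low azimuths and linear gaps -/
  have hGpos : 0 < Gr := by
    have := arccos_sqrt_third_bounds.1; unfold Gr; linarith
  have hinj : ∀ u ∈ L, ∀ u' ∈ L, A u = A u' → u = u' := by
    intro u hu u' hu' h
    by_contra hne
    have := (pairLL hu hu' hne).1.1
    rw [h, sub_self, abs_zero] at this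
    linarith
  have hGlin : ∀ u ∈ L, ∀ u' ∈ L, A u < A u' → Gr ≤ A u' - A u := by
    intro u hu u' hu' hlt
    have hne : u ≠ u' := by rintro rfl; exact lt_irrefl _ hlt
    have := (pairLL hu hu' hne).1.1
    rwa [abs_of_pos (by linarith)] at this
  have hGabs : ∀ u ∈ L, ∀ u' ∈ L, u ≠ u' → Gr ≤ |A u' - A u| ∧ Gr ≤ 2 * π - |A u' - A u| :=
    fun u hu u' hu' hne => (pairLL hu hu' hne).1
  have hLrange : ∀ u ∈ L, 0 ≤ A u ∧ A u < 2 * π := fun u _ => hArange u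
  /- the high–low bounds in the four linear forms -/
  have hHLlin : ∀ {h u}, h ∈ T → u ∈ L → 1 / 2 < ⟪e, h⟫ → ⟪e, h⟫ < 1 →
      (A h ≤ A u → Dr ⟪e, h⟫ ≤ A u - A h) ∧ (A u ≤ A h → Dr ⟪e, h⟫ ≤ A h - A u) ∧
        Dr ⟪e, h⟫ ≤ 2 * π - (A u - A h) ∧ Dr ⟪e, h⟫ ≤ 2 * π - (A h - A u) := by
    intro h u hh hu hw hw1
    obtain ⟨⟨h1, h2⟩, -⟩ := pairHL hh hu hw hw1
    refine ⟨fun hle => ?_, fun hle => ?_, ?_, ?_⟩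
    · rwa [abs_of_nonneg (by linarith)] at h1
    · rw [abs_of_nonpos (by linarith)] at h1; linarith
    · linarith [le_abs_self (A u - A h)]
    · linarith [neg_abs_le (A u - A h)]
  /- the three sector counts -/
  obtain ⟨m₁, hm₁⟩ : ∃ m : ℕ, m = (L.filter fun u => A u < A h₂).card := ⟨_, rfl⟩
  obtain ⟨m₂, hm₂⟩ : ∃ m : ℕ, m = (L.filter fun u => A h₂ ≤ A u ∧ A u < A h₃).card := ⟨_, rfl⟩
  obtain ⟨m₃, hm₃⟩ : ∃ m : ℕ, m = (L.filter fun u => A h₃ ≤ A u).card := ⟨_, rfl⟩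
  have hLcard : L.card = 6 := hL6
  have hsplit₁ := Finset.card_filter_add_card_filter_not
    (s := L) (fun u => A u < A h₂)
  have hsplit₂ := Finset.card_filter_add_card_filter_not
    (s := L.filter fun u => ¬ A u < A h₂) (fun u => A u < A h₃)
  have hF₂ : ((L.filter fun u => ¬ A u < A h₂).filter fun u => A u < A h₃) =
      L.filter fun u => A h₂ ≤ A u ∧ A u < A h₃ := by
    rw [Finset.filter_filter]
    exact Finset.filter_congr fun u _ => by rw [not_lt]
  have hF₃ : ((L.filter fun u => ¬ A u < A h₂).filter fun u => ¬ A u < A h₃) =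
      L.filter fun u => A h₃ ≤ A u := by
    rw [Finset.filter_filter]
    refine Finset.filter_congr fun u _ => ?_
    rw [not_lt, not_lt]
    exact ⟨fun h => h.2, fun h => ⟨hφ23.trans h, h⟩⟩
  have hN₁ : (L.filter fun u => ¬ A u < A h₂) = L.filter fun u => A h₂ ≤ A u :=
    Finset.filter_congr fun u _ => by rw [not_lt]
  rw [hF₂, hF₃, ← hm₂, ← hm₃] at hsplit₂
  rw [← hm₁, hLcard] at hsplit₁
  have hm : m₁ + m₂ + m₃ = 6 := by omega
  -- unions used by the complementary arcs
  have hF₂₃ : (L.filter fun u => A h₂ ≤ A u).card = m₂ + m₃ := by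
    rw [← hN₁]; omega
  have hF₁₂ : (L.filter fun u => A u < A h₃).card = m₁ + m₂ := by
    have h' := Finset.card_filter_add_card_filter_not
      (s := L.filter fun u => A u < A h₃) (fun u => A u < A h₂)
    have e1 : ((L.filter fun u => A u < A h₃).filter fun u => A u < A h₂) =
        L.filter fun u => A u < A h₂ := by
      rw [Finset.filter_filter]
      exact Finset.filter_congr fun u _ => ⟨fun h => h.2, fun h => ⟨lt_of_lt_of_le h hφ23, h⟩⟩
    have e2 : ((L.filter fun u => A u < A h₃).filter fun u => ¬ A u < A h₂) =
        L.filter fun u => A h₂ ≤ A u ∧ A u < A h₃ := by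
      rw [Finset.filter_filter]
      exact Finset.filter_congr fun u _ => by rw [not_lt, and_comm]
    rw [e1, e2, ← hm₁, ← hm₂] at h'
    omega
  have hF₃₁ : (L.filter fun u => A h₃ ≤ A u ∨ A u < A h₂).card = m₃ + m₁ := by
    rw [Finset.filter_or, Finset.card_union_of_disjoint, ← hm₃, ← hm₁]
    exact Finset.disjoint_filter.2 fun u _ h h' => by linarith
  have hFall : (L.filter fun _ => True).card = 6 := by
    rw [Finset.filter_true_of_mem fun _ _ => trivial]; exact hLcard
  /- the crude budget hypotheses -/
  have hD₁ := fun {u} (hu : u ∈ L) => hHLlin hh₁ hu hw₁ hw₁1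
  have hD₂ := fun {u} (hu : u ∈ L) => hHLlin hh₂ hu hw₂ hw₂1
  have hD₃ := fun {u} (hu : u ∈ L) => hHLlin hh₃ hu hw₃ hw₃1
  obtain ⟨hc₁₂, hA₁₂, hA₁₂'⟩ := pairHH hh₁ hh₂ h12 hw₁ hw₁1 hw₂ hw₂1
  obtain ⟨hc₂₃, hA₂₃, hA₂₃'⟩ := pairHH hh₂ hh₃ h23 hw₂ hw₂1 hw₃ hw₃1
  obtain ⟨hc₃₁, hA₃₁, hA₃₁'⟩ := pairHH hh₃ hh₁ h13.symm hw₃ hw₃1 hw₁ hw₁1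
  rw [abs_of_nonneg (by linarith : 0 ≤ A h₂ - A h₁)] at hA₁₂ hA₁₂'
  rw [abs_of_nonneg (by linarith : 0 ≤ A h₃ - A h₂)] at hA₂₃ hA₂₃'
  rw [abs_of_nonpos (by linarith : A h₁ - A h₃ ≤ 0)] at hA₃₁ hA₃₁'
  have HC : CrudeHyps m₁ m₂ m₃ ⟪e, h₁⟫ ⟪e, h₂⟫ ⟪e, h₃⟫ (A h₂ - A h₁) (A h₃ - A h₂)
      (2 * π - A h₃) := by
    refine
      { hw₁ := ⟨hw₁, hw₁1⟩, hw₂ := ⟨hw₂, hw₂1⟩, hw₃ := ⟨hw₃, hw₃1⟩,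
        hsum := by rw [hA1]; ring,
        hc₁₂ := hc₁₂, hc₂₃ := hc₂₃, hc₃₁ := hc₃₁,
        jump₁ := hA₁₂, jump₂ := hA₂₃, jump₃ := by linarith,
        jump₁' := by linarith, jump₂' := by linarith, jump₃' := by linarith,
        walk₁ := ?_, walk₂ := ?_, walk₃ := ?_, walk₁' := ?_, walk₂' := ?_, walk₃' := ?_,
        full₁ := ?_, full₂ := ?_, full₃ := ?_ }
    · -- sector 1: `[A h₁, A h₂]`
      have := walkR_filter_le L (fun u => A u < A h₂) A (α := A h₁) (β := A h₂)
        (Da := Dr ⟪e, h₁⟫) (Db := Dr ⟪e, h₂⟫) (G := Gr) hinj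
        (fun u hu _ => (hD₁ hu).1 (by linarith [(hArange u).1]))
        (fun u hu hP => (hD₂ hu).2.1 hP.le) hGlin (by linarith)
      rwa [← hm₁] at this
    · -- sector 2: `[A h₂, A h₃]`
      have := walkR_filter_le L (fun u => A h₂ ≤ A u ∧ A u < A h₃) A (α := A h₂) (β := A h₃)
        (Da := Dr ⟪e, h₂⟫) (Db := Dr ⟪e, h₃⟫) (G := Gr) hinj
        (fun u hu hP => (hD₂ hu).1 hP.1)
        (fun u hu hP => (hD₃ hu).2.1 hP.2.le) hGlin (by linarith)
      rwa [← hm₂] at this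
    · -- sector 3: `[A h₃, 2π]` (far end `h₁`)
      have := walkR_filter_le L (fun u => A h₃ ≤ A u) A (α := A h₃) (β := 2 * π + A h₁)
        (Da := Dr ⟪e, h₃⟫) (Db := Dr ⟪e, h₁⟫) (G := Gr) hinj
        (fun u hu hP => (hD₃ hu).1 hP)
        (fun u hu _ => by linarith [(hD₁ hu).2.2.1]) hGlin (by linarith)
      rw [← hm₃] at this
      exact this.trans_eq (by rw [hA1]; ring)
    · -- complement of sector 1: `[A h₂, 2π]`
      have := walkR_filter_le L (fun u => A h₂ ≤ A u) A (α := A h₂) (β := 2 * π + A h₁)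
        (Da := Dr ⟪e, h₂⟫) (Db := Dr ⟪e, h₁⟫) (G := Gr) hinj
        (fun u hu hP => (hD₂ hu).1 hP)
        (fun u hu _ => by linarith [(hD₁ hu).2.2.1]) hGlin (by linarith)
      rw [hF₂₃] at this
      exact this.trans_eq (by rw [hA1]; ring)
    · -- complement of sector 2: wraps, from `A h₃` round to `A h₂ + 2π`
      have := walkR_filter_le_wrap L (fun u => A h₃ ≤ A u ∨ A u < A h₂) A (α := A h₃)
        (β := A h₂) (Da := Dr ⟪e, h₃⟫) (Db := Dr ⟪e, h₂⟫) (G := Gr) hinj hLrange hφ23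
        (fun u _ hP => hP) (fun u hu _ => (pairHL hh₃ hu hw₃ hw₃1).1)
        (fun u hu _ => (pairHL hh₂ hu hw₂ hw₂1).1) hGabs (by linarith)
      rw [hF₃₁] at this
      exact this.trans_eq (by rw [hA1]; ring)
    · -- complement of sector 3: `[A h₁, A h₃]`
      have := walkR_filter_le L (fun u => A u < A h₃) A (α := A h₁) (β := A h₃)
        (Da := Dr ⟪e, h₁⟫) (Db := Dr ⟪e, h₃⟫) (G := Gr) hinj
        (fun u hu _ => (hD₁ hu).1 (by linarith [(hArange u).1]))
        (fun u hu hP => (hD₃ hu).2.1 hP.le) hGlin (by linarith)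
      rw [hF₁₂] at this
      exact this.trans_eq (by ring)
    · -- full circle from `h₁`
      have := walkR_filter_le L (fun _ => True) A (α := A h₁) (β := 2 * π + A h₁)
        (Da := Dr ⟪e, h₁⟫) (Db := Dr ⟪e, h₁⟫) (G := Gr) hinj
        (fun u hu _ => (hD₁ hu).1 (by linarith [(hArange u).1]))
        (fun u hu _ => by linarith [(hD₁ hu).2.2.1]) hGlin (by linarith [Real.pi_pos])
      rw [hFall] at this
      unfold walkR at this
      rw [if_neg (by norm_num : (6 : ℕ) ≠ 0)] at this
      push_cast at this
      linarith
    · -- full circle from `h₂` (wrapping)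
      have := walkR_filter_le_wrap L (fun _ => True) A (α := A h₂) (β := A h₂)
        (Da := Dr ⟪e, h₂⟫) (Db := Dr ⟪e, h₂⟫) (G := Gr) hinj hLrange le_rfl
        (fun u _ _ => le_or_gt (A h₂) (A u))
        (fun u hu _ => (pairHL hh₂ hu hw₂ hw₂1).1) (fun u hu _ => (pairHL hh₂ hu hw₂ hw₂1).1)
        hGabs (by linarith [Real.pi_pos])
      rw [hFall] at this
      unfold walkR at this
      rw [if_neg (by norm_num : (6 : ℕ) ≠ 0)] at this
      push_cast at this
      linarith
    · -- full circle from `h₃` (wrapping)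
      have := walkR_filter_le_wrap L (fun _ => True) A (α := A h₃) (β := A h₃)
        (Da := Dr ⟪e, h₃⟫) (Db := Dr ⟪e, h₃⟫) (G := Gr) hinj hLrange le_rfl
        (fun u _ _ => le_or_gt (A h₃) (A u))
        (fun u hu _ => (pairHL hh₃ hu hw₃ hw₃1).1) (fun u hu _ => (pairHL hh₃ hu hw₃ hw₃1).1)
        hGabs (by linarith [Real.pi_pos])
      rw [hFall] at this
      unfold walkR at this
      rw [if_neg (by norm_num : (6 : ℕ) ≠ 0)] at this
      push_cast at this
      linarith
  /- only `(2,2,2)` survives; the window -/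
  have h222 : (m₁, m₂, m₃) = (2, 2, 2) := by
    by_contra hne
    exact crude_pattern hm hne HC
  simp only [Prod.mk.injEq] at h222
  obtain ⟨e1, e2, e3⟩ := h222
  subst e1 e2 e3
  obtain ⟨⟨hlo₁, hhi₁⟩, ⟨hlo₂, hhi₂⟩, ⟨hlo₃, hhi₃⟩⟩ := crude_window HC
  /- the three sectors hold two low points each; exact walks with the lift penalty -/
  have two : ∀ (P : EuclideanSpace ℝ (Fin 3) → Prop) [DecidablePred P], (L.filter P).card = 2 →
      ∃ u ∈ L, ∃ u' ∈ L, P u ∧ P u' ∧ A u < A u' ∧ ∀ v ∈ L, P v → v = u ∨ v = u' := by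
    intro P _ h2
    obtain ⟨x, y, hxy, hS⟩ := Finset.card_eq_two.1 h2
    have hx : x ∈ L.filter P := by rw [hS]; simp
    have hy : y ∈ L.filter P := by rw [hS]; simp
    rw [Finset.mem_filter] at hx hy
    have hall : ∀ v ∈ L, P v → v = x ∨ v = y := by
      intro v hv hPv
      have : v ∈ L.filter P := Finset.mem_filter.2 ⟨hv, hPv⟩
      rw [hS] at this
      simpa using this
    rcases lt_or_gt_of_ne (fun h => hxy (hinj x hx.1 y hy.1 h)) with hlt | hlt
    · exact ⟨x, hx.1, y, hy.1, hx.2, hy.2, hlt, hall⟩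
    · exact ⟨y, hy.1, x, hx.1, hy.2, hx.2, hlt, fun v hv hPv => (hall v hv hPv).symm⟩
  obtain ⟨u₁, hu₁, u₁', hu₁', hP₁, hP₁', hlt₁, hall₁⟩ := two _ hm₁.symm
  obtain ⟨u₂, hu₂, u₂', hu₂', hP₂, hP₂', hlt₂, hall₂⟩ := two _ hm₂.symm
  obtain ⟨u₃, hu₃, u₃', hu₃', hP₃, hP₃', hlt₃, hall₃⟩ := two _ hm₃.symm
  -- square bounds for the lift penalty
  have hsq : ∀ {w : ℝ}, 1 / 2 < w → w < 0.84 → w ^ 2 ≤ 3 / 4 := fun hw0 hw => by nlinarith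
  have h7 : ∀ {w : ℝ}, 0.78 < w → 7 / 10 ≤ w := fun hw => by linarith
  -- sector 1
  have ne₁ : u₁ ≠ u₁' := by rintro rfl; exact lt_irrefl _ hlt₁
  obtain ⟨-, hx₁, -⟩ := pairHL hh₁ hu₁ hw₁ hw₁1
  obtain ⟨-, hg₁, -⟩ := pairLL hu₁ hu₁' ne₁
  obtain ⟨-, hy₁, -⟩ := pairHL hh₂ hu₁' hw₂ hw₂1
  rw [abs_of_nonneg (by linarith [(hArange u₁).1] : 0 ≤ A u₁ - A h₁)] at hx₁
  rw [abs_of_pos (by linarith : 0 < A u₁' - A u₁)] at hg₁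
  rw [abs_of_neg (by linarith [hP₁'] : A u₁' - A h₂ < 0)] at hy₁
  have pen₁ := sector_lift_penalty (h7 hlo₁) (hsq hw₁ hhi₁) (h7 hlo₂) (hsq hw₂ hhi₂) (hLz hu₁).1
    (hLz hu₁).2.le (hLz hu₁').1 (hLz hu₁').2.le
  -- sector 2
  have ne₂ : u₂ ≠ u₂' := by rintro rfl; exact lt_irrefl _ hlt₂
  obtain ⟨-, hx₂, -⟩ := pairHL hh₂ hu₂ hw₂ hw₂1
  obtain ⟨-, hg₂, -⟩ := pairLL hu₂ hu₂' ne₂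
  obtain ⟨-, hy₂, -⟩ := pairHL hh₃ hu₂' hw₃ hw₃1
  rw [abs_of_nonneg (by linarith [hP₂.1] : 0 ≤ A u₂ - A h₂)] at hx₂
  rw [abs_of_pos (by linarith : 0 < A u₂' - A u₂)] at hg₂
  rw [abs_of_neg (by linarith [hP₂'.2] : A u₂' - A h₃ < 0)] at hy₂
  have pen₂ := sector_lift_penalty (h7 hlo₂) (hsq hw₂ hhi₂) (h7 hlo₃) (hsq hw₃ hhi₃) (hLz hu₂).1
    (hLz hu₂).2.le (hLz hu₂').1 (hLz hu₂').2.le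
  -- sector 3 (far end `h₁` at `2π`)
  have ne₃ : u₃ ≠ u₃' := by rintro rfl; exact lt_irrefl _ hlt₃
  obtain ⟨-, hx₃, -⟩ := pairHL hh₃ hu₃ hw₃ hw₃1
  obtain ⟨-, hg₃, -⟩ := pairLL hu₃ hu₃' ne₃
  obtain ⟨-, -, hy₃⟩ := pairHL hh₁ hu₃' hw₁ hw₁1
  rw [abs_of_nonneg (by linarith [hP₃] : 0 ≤ A u₃ - A h₃)] at hx₃
  rw [abs_of_pos (by linarith : 0 < A u₃' - A u₃)] at hg₃
  rw [abs_of_nonneg (by linarith [(hArange u₃').1] : 0 ≤ A u₃' - A h₁)] at hy₃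
  have pen₃ := sector_lift_penalty (h7 hlo₃) (hsq hw₃ hhi₃) (h7 hlo₁) (hsq hw₁ hhi₁) (hLz hu₃).1
    (hLz hu₃).2.le (hLz hu₃').1 (hLz hu₃').2.le
  have hA3' := (hArange u₃').2
  /- the `z = 0` budget and the cube -/
  have HS : SixtyHyps ⟪e, h₁⟫ ⟪e, h₂⟫ ⟪e, h₃⟫ (A h₂ - A h₁) (A h₃ - A h₂) (2 * π - A h₃) :=
    { hw₁ := ⟨by linarith, by linarith⟩, hw₂ := ⟨by linarith, by linarith⟩,
      hw₃ := ⟨by linarith, by linarith⟩,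
      hsum := by rw [hA1]; ring,
      hc₁₂ := hc₁₂, hc₂₃ := hc₂₃, hc₃₁ := hc₃₁,
      jump₁ := hA₁₂, jump₂ := hA₂₃, jump₃ := by linarith,
      walk₁ := by unfold Dr; linarith [(hLz hu₁).1, (hLz hu₁').1],
      walk₂ := by unfold Dr; linarith [(hLz hu₂).1, (hLz hu₂').1],
      walk₃ := by unfold Dr; rw [hA1] at hy₃; linarith [(hLz hu₃).1, (hLz hu₃').1] }
  obtain ⟨⟨c₁0, c₁1⟩, ⟨c₂0, c₂1⟩, ⟨c₃0, c₃1⟩⟩ := sixty_cube HS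
  /- local rigidity: the penalties vanish -/
  have rig := kertesz_local_rigidity c₁0 c₁1 c₂0 c₂1 c₃0 c₃1
    (p₁₂ := (⟪e, u₁⟫ + ⟪e, u₁'⟫) / 4) (p₂₃ := (⟪e, u₂⟫ + ⟪e, u₂'⟫) / 4)
    (p₃₁ := (⟪e, u₃⟫ + ⟪e, u₃'⟫) / 4)
    (by linarith [(hLz hu₁).1, (hLz hu₁').1]) (by linarith [(hLz hu₂).1, (hLz hu₂').1])
    (by linarith [(hLz hu₃).1, (hLz hu₃').1]) ?_
  swap
  · -- every cover is at most `2π`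
    have hj₁ : Ar ⟪e, h₁⟫ ⟪e, h₂⟫ ≤ A h₂ - A h₁ := hA₁₂
    have hj₂ : Ar ⟪e, h₂⟫ ⟪e, h₃⟫ ≤ A h₃ - A h₂ := hA₂₃
    have hj₃ : Ar ⟪e, h₃⟫ ⟪e, h₁⟫ ≤ 2 * π - A h₃ := by linarith
    unfold Ar cr at hj₁ hj₂ hj₃
    have hk₁ : arccos (1 / (2 * √(1 - ⟪e, h₁⟫ ^ 2))) + arccos (1 / (2 * √(1 - ⟪e, h₂⟫ ^ 2))) +
        π / 3 + (⟪e, u₁⟫ + ⟪e, u₁'⟫) / 4 ≤ A h₂ - A h₁ := by linarith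
    have hk₂ : arccos (1 / (2 * √(1 - ⟪e, h₂⟫ ^ 2))) + arccos (1 / (2 * √(1 - ⟪e, h₃⟫ ^ 2))) +
        π / 3 + (⟪e, u₂⟫ + ⟪e, u₂'⟫) / 4 ≤ A h₃ - A h₂ := by linarith
    have hk₃ : arccos (1 / (2 * √(1 - ⟪e, h₃⟫ ^ 2))) + arccos (1 / (2 * √(1 - ⟪e, h₁⟫ ^ 2))) +
        π / 3 + (⟪e, u₃⟫ + ⟪e, u₃'⟫) / 4 ≤ 2 * π - A h₃ := by rw [hA1] at hy₃; linarith
    have hs : (A h₂ - A h₁) + (A h₃ - A h₂) + (2 * π - A h₃) = 2 * π := by rw [hA1]; ring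
    intro j₁₂ j₂₃ j₃₁
    cases j₁₂ <;> cases j₂₃ <;> cases j₃₁ <;> simp only [Bool.false_eq_true, ↓reduceIte] <;>
      linarith
  obtain ⟨p₁, p₂, p₃, -, -, -⟩ := rig
  have z₁ : ⟪e, u₁⟫ = 0 ∧ ⟪e, u₁'⟫ = 0 := by
    constructor <;> linarith [(hLz hu₁).1, (hLz hu₁').1]
  have z₂ : ⟪e, u₂⟫ = 0 ∧ ⟪e, u₂'⟫ = 0 := by
    constructor <;> linarith [(hLz hu₂).1, (hLz hu₂').1]
  have z₃ : ⟪e, u₃⟫ = 0 ∧ ⟪e, u₃'⟫ = 0 := by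
    constructor <;> linarith [(hLz hu₃).1, (hLz hu₃').1]
  /- every low point is one of the six -/
  intro v hv hvlow
  have hvL : v ∈ L := Finset.mem_filter.2 ⟨hv, hvlow⟩
  by_cases c1 : A v < A h₂
  · rcases hall₁ v hvL c1 with rfl | rfl
    · exact z₁.1
    · exact z₁.2
  · by_cases c2 : A v < A h₃
    · rcases hall₂ v hvL ⟨not_lt.1 c1, c2⟩ with rfl | rfl
      · exact z₂.1
      · exact z₂.2
    · rcases hall₃ v hvL (not_lt.1 c2) with rfl | rfl
      · exact z₃.1
      · exact z₃.2

/-! ### The discharge -/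

/-- **Kertész 1994: the low points of a nine-point one-sided arrangement are equatorial.**  Nine
unit vectors of `ℝ³` in the closed hemisphere `⟪e, ·⟫ ≥ 0` with pairwise distances `≥ 1`: every point
of height `< 1/2` has height `0`. [cite: Kertesz1994, Theorem] -/
theorem kertesz1994_low_equatorial :
    ∀ e : EuclideanSpace ℝ (Fin 3), ‖e‖ = 1 → ∀ T : Finset (EuclideanSpace ℝ (Fin 3)),
      (∀ v ∈ T, ‖v‖ = 1) → (∀ v ∈ T, 0 ≤ ⟪e, v⟫) →
      (∀ v ∈ T, ∀ w ∈ T, v ≠ w → 1 ≤ dist v w) → T.card = 9 →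
        ∀ v ∈ T, ⟪e, v⟫ < 1 / 2 → ⟪e, v⟫ = 0 := by
  intro e he T hn hhemi hsep h9
  classical
  obtain ⟨hH3, -, -⟩ := nine_point_structure he hn hhemi hsep h9
  obtain ⟨p, q, r, hpq, hpr, hqr, hHeq⟩ := Finset.card_eq_three.1 hH3
  have hmem : ∀ {x}, x ∈ ({p, q, r} : Finset (EuclideanSpace ℝ (Fin 3))) →
      x ∈ T ∧ 1 / 2 < ⟪e, x⟫ := by
    intro x hx
    rw [← hHeq, Finset.mem_filter] at hx
    exact hx
  have hp := hmem (x := p) (by simp)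
  have hq := hmem (x := q) (by simp)
  have hr := hmem (x := r) (by simp)
  obtain ⟨b, hb⟩ := exists_orthonormalBasis_third_eq (v := (2 : ℝ) • e)
    (by rw [norm_smul, he]; norm_num)
  have hb2 : b 2 = e := by
    rw [hb, smul_smul]; norm_num
  have core := @low_equatorial_of_frame e he T hn hhemi hsep h9 b hb2
  set θ : EuclideanSpace ℝ (Fin 3) → ℝ := fun u => Complex.arg ⟨⟪b 0, u⟫, ⟪b 1, u⟫⟩ with hθ
  rcases le_total (θ p) (θ q) with hpq' | hqp' <;> rcases le_total (θ q) (θ r) with hqr' | hrq' <;>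
    rcases le_total (θ p) (θ r) with hpr' | hrp'
  · exact core hp.1 hq.1 hr.1 hpq hpr hqr hp.2 hq.2 hr.2 hpq' hqr'
  · exact core hp.1 hq.1 hr.1 hpq hpr hqr hp.2 hq.2 hr.2 hpq' hqr'
  · exact core hp.1 hr.1 hq.1 hpr hpq hqr.symm hp.2 hr.2 hq.2 hpr' hrq'
  · exact core hr.1 hp.1 hq.1 hpr.symm hqr.symm hpq hr.2 hp.2 hq.2 hrp' hpq'
  · exact core hq.1 hp.1 hr.1 hpq.symm hqr hpr hq.2 hp.2 hr.2 hqp' hpr'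
  · exact core hq.1 hr.1 hp.1 hqr hpq.symm hpr.symm hq.2 hr.2 hp.2 hqr' hrp'
  · exact core hr.1 hq.1 hp.1 hqr.symm hpr.symm hpq.symm hr.2 hq.2 hp.2 hrq' hqp'
  · exact core hr.1 hq.1 hp.1 hqr.symm hpr.symm hpq.symm hr.2 hq.2 hp.2 hrq' hqp'

/-- **Kertész 1994, Theorem** (discharge of the named fact `kertesz1994_ninePointsHemisphere`):
nine non-overlapping unit balls touching a unit ball `B` at points of a closed hemisphere touch it
in at least six points of the boundary great circle. [cite: Kertesz1994, Theorem] -/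
theorem kertesz1994_ninePointsHemisphere_holds : kertesz1994_ninePointsHemisphere :=
  kertesz1994_ninePointsHemisphere_iff_low_equatorial.2 kertesz1994_low_equatorial

/-- **Kertész 1994, Theorem**, in the wording of `OneSidedKissingNumberThree.lean` (any non-zero
normal `e`): discharge of the named fact `kertesz1994_nineHemisphere`. [cite: Kertesz1994, Theorem] -/
theorem kertesz1994_nineHemisphere_holds : kertesz1994_nineHemisphere :=
  kertesz1994_ninePointsHemisphere_iff_nineHemisphere.1 kertesz1994_ninePointsHemisphere_holds

/-! ### Corollaries, now unconditional -/

/-- **At most eight unit vectors pairwise at distance `≥ 1` in an OPEN hemisphere** (`⟪e, v⟫ > 0` for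
all `v`): the tree's `card_le_eight_of_openHemisphere` fed with `kertesz1994_ninePointsHemisphere_holds`
("the points … do not lie in an open hemisphere", Zbl 0822.52005). [cite: Kertesz1994, Theorem (corollary)] -/
theorem card_le_eight_of_openHemisphere' {e : EuclideanSpace ℝ (Fin 3)} (he : ‖e‖ = 1)
    {T : Finset (EuclideanSpace ℝ (Fin 3))} (hn : ∀ v ∈ T, ‖v‖ = 1) (hpos : ∀ v ∈ T, 0 < ⟪e, v⟫)
    (hsep : ∀ v ∈ T, ∀ w ∈ T, v ≠ w → 1 ≤ dist v w) : T.card ≤ 8 :=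
  card_le_eight_of_openHemisphere kertesz1994_ninePointsHemisphere_holds he hn hpos hsep

/-- **No finite nine-neighbour one-sided contact**: balls of unit diameter centred at the points of `X`,
pairwise non-overlapping, all touching the ball centred at `q` from strictly one side of a plane through
`q`, number at most eight — the tree's `card_lowerContacts_le_eight` fed with
`kertesz1994_ninePointsHemisphere_holds`. [cite: BrassMoserPach2005, §2.4 (remark before Problem 6)]
[cite: Kertesz1994, Theorem (corollary)] -/
theorem card_lowerContacts_le_eight' {e : EuclideanSpace ℝ (Fin 3)} (he : ‖e‖ = 1)
    (q : EuclideanSpace ℝ (Fin 3)) {X : Finset (EuclideanSpace ℝ (Fin 3))}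
    (hsep : ∀ x ∈ X, ∀ y ∈ X, x ≠ y → 1 ≤ dist x y)
    (htouch : ∀ x ∈ X, dist q x = 1) (hside : ∀ x ∈ X, 0 < ⟪e, x - q⟫) : X.card ≤ 8 :=
  card_lowerContacts_le_eight kertesz1994_ninePointsHemisphere_holds he q hsep htouch hside

/-- **Nine one-sided points never fit in an open hemisphere**: in the setting of the named fact, some
point lies ON the equator. [cite: Kertesz1994, Theorem (corollary)] -/
theorem exists_equatorial_of_nine {e : EuclideanSpace ℝ (Fin 3)} (he : ‖e‖ = 1)
    {T : Finset (EuclideanSpace ℝ (Fin 3))} (hn : ∀ v ∈ T, ‖v‖ = 1) (hhemi : ∀ v ∈ T, 0 ≤ ⟪e, v⟫)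
    (hsep : ∀ v ∈ T, ∀ w ∈ T, v ≠ w → 1 ≤ dist v w) (h9 : T.card = 9) : ∃ v ∈ T, ⟪e, v⟫ = 0 := by
  classical
  have h6 := kertesz1994_ninePointsHemisphere_holds e he T hn hhemi hsep h9
  have hne : (T.filter fun v => ⟪e, v⟫ = 0).Nonempty := by
    rw [← Finset.card_pos]; omega
  obtain ⟨v, hv⟩ := hne
  exact ⟨v, (Finset.mem_filter.1 hv).1, (Finset.mem_filter.1 hv).2⟩

end Literature.Geometry.DiscreteGeometry

end
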